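import Summits.QuantumFields.BalabanUV.T4Continuum.Support.TermwiseBackgroundEstimates

/-!
# TermwiseBackground (part 3/3) — the binders `hαK`, (44), (44∇), `hdecay`, `hα₁K` from `LocReg`; the two capstones

HONEST FRAMING, PLACEMENT, ABSOLUTE RULE: see part 1/3 (`Support/TermwiseBackground`), whose module docstring
governs this file verbatim: FIXED FINITE four-torus, rung (B)+1, conditional; NOT infinite volume, NOT a mass
gap, NOT the Clay statement; the spine estimate NE7 is NOT PRINTED in [Balaban1984PropagatorsI]–
[Balaban1989LargeFieldII] and NOT proved here; no sentence of print is quoted; every hypothesis is a NAMED binder.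

Contents: §6 `U(N)`, `d = 4`, one tower: `binders_of_locReg` produces `hαK`, (44), (44∇), `hdecay` (with
`c_α = cReg`), `hα₁K` (with `c_{α1} = cOscReg`) from `LocReg` at every site with radii
`(a₀, a₁, a₂)·ε₁·L^{−K,−2K,−3K}`, `ε₁ ≤ 1` and the smallness `20480·L²·cReg·ε₁ ≤ 1`; then ONE CALL each of
generation 13's `T4TermwiseChainUN.interpolation_averaging_UN` / `goodClause_summable_UN`:
`interpolation_averaging_UN_of_locReg` (§6), `goodClause_summable_UN_of_locReg` (§7; every other binder carried
BY NAME — whether the two runs' backgrounds satisfy `LocReg` is the hypothesis `hAreg`/`hBreg`, not a claim);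
§8 toys (non-vacuity: the constant configuration is `LocReg` with `(0,0,0)`; the smallness is satisfiable).
-/

noncomputable section

open Finset MeasureTheory _root_.Filter _root_.Topology NormedSpace
open scoped BigOperators Matrix.Norms.L2Operator InnerProductSpace

namespace Summit.QuantumFields.BalabanUV.T4Continuum.TermwiseBackground

open Literature.MathematicalPhysics.QuantumFieldTheory.Balaban1983to89
open T4OutputRate T4RecentScale T4GoodClassBudget T4CauchySum T4Crossover T4TowerRateComposition T4TowerRateDischarge
open T4BoundaryCarrier (BFunctional atFl NE9Fl LipBackgroundFl NE5B)
open T4TermwiseBudget T4TermwiseDeviation T4TermwiseCurrency T4TermwiseBoundary T4TermwiseResidual T4TermwiseAction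
open T4TermwiseClassical T4TermwiseQuartic
open T4TermwiseInstantiate (cBCH cBCH_nonneg cSZ cSZ_nonneg)
open T4TermwiseOscillation (cOSC)
open B7Prop1Explicit B7Prop2Explicit T4TermwiseBCH T4TermwiseTorus T4TermwiseUN T4TermwiseChainUN

/-! ## §6 `U(N)`, `d = 4`, one tower: the binders `hαK`, (44), (44∇), `hdecay`, `hα₁K` of generation 13's producers
DERIVED from `LocReg` at every site; then ONE CALL of each producer -/

section UN

variable {n : Type*} [Fintype n] [DecidableEq n] [Nonempty n]

/-- The covariant oscillation of the plaquette logarithm `phiM` from `LocReg`, `U(N)`-valued (or any matrix)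
configuration. [folklore] -/
theorem phiM_osc_le_of_locReg {d : ℕ} {V : B7Prop1Explicit.Site d → Fin d → (Matrix n n ℂ)ˣ}
    {z : B7Prop1Explicit.Site d} {R : ℕ} {b₀ b₁ b₂ : ℝ} (h : LocReg V z R b₀ b₁ b₂) (hR : 5 ≤ R) (hb₀ : 0 ≤ b₀)
    (hb₀' : b₀ ≤ 1 / 64) (hb₁ : 0 ≤ b₁) (P : Fin d × Fin d) (κ : Fin d) :
    ‖((V z κ : (Matrix n n ℂ)ˣ) : Matrix n n ℂ) * phiM V P (z + e κ) * (((V z κ)⁻¹ : (Matrix n n ℂ)ˣ) : Matrix n n ℂ)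
        - phiM V P z‖ ≤ 4 * b₂ + 100 * b₀ * b₁ + 132 * b₀ ^ 3 :=
  h.norm_cov_osc_le hR hb₀ hb₀' hb₁ κ P.1 P.2

variable {ι : Type} {σ : Type*} [DecidableEq σ] {l₀ : ℝ} {T : ℕ → Finset σ} {Bad : ℕ → ℝ → Finset σ} {Adm : Set ι}

/-- **THE BACKGROUND BINDERS FROM LOCAL REGULARITY (one tower).**  If at every level `K` (on the good class) the
background `V_K` is `LocReg` about every site with radius `5` and bounds `a₀ε₁L^{−K}`, `a₁ε₁L^{−2K}`, `a₂ε₁L^{−3K}`,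
`ε₁ ≤ 1` and `20480·L²·cReg·ε₁ ≤ 1`, then: the smallness `hαK` and (44) hold with `α₀(K) = cReg·ε₁·L^{−2K}` (so the
(B)-type law `hdecay` holds with `c_α = cReg`, by `le_rfl`), and (44∇) holds with
`α₁(K) = (4a₂ + 100a₀a₁ + 132a₀³)·ε₁·L^{−3K}`, which obeys the (B∇)-type law `hα₁K` with `c_{α1} = cOscReg` (an
identity of powers of `L`).  The geometric factors `L^{−2K}`, `L^{−3K}` are `b₁ + b₀²` and `b₂ + b₀b₁ + b₀³`.
[folklore] -/
theorem binders_of_locReg (L : ℕ) (hL : 2 ≤ L)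
    (VA : ℕ → ℝ → σ → ι → (B7Prop1Explicit.Site 4 → Fin 4 → (Matrix n n ℂ)ˣ)) {a₀ a₁ a₂ ε₁ : ℝ}
    (ha₀ : 0 ≤ a₀) (ha₁ : 0 ≤ a₁) (ha₂ : 0 ≤ a₂) (hε₁ : 0 ≤ ε₁) (hε₁1 : ε₁ ≤ 1)
    (hsmall : 20480 * (L : ℝ) ^ 2 * (cReg a₀ a₁ * ε₁) ≤ 1)
    (hreg : ∀ K t, |t| ≤ l₀ → ∀ τ ∈ T K \ Bad K t, ∀ v ∈ Adm, ∀ z : B7Prop1Explicit.Site 4,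
      LocReg (VA K t τ v) z 5 (a₀ * ε₁ * ((L : ℝ) ^ K)⁻¹) (a₁ * ε₁ * (((L : ℝ) ^ K)⁻¹) ^ 2)
        (a₂ * ε₁ * (((L : ℝ) ^ K)⁻¹) ^ 3)) :
    (∀ K, 0 ≤ cReg a₀ a₁ * ε₁ * (((L : ℝ) ^ K)⁻¹) ^ 2 ∧
      20480 * (L : ℝ) ^ 2 * (cReg a₀ a₁ * ε₁ * (((L : ℝ) ^ K)⁻¹) ^ 2) ≤ 1) ∧
    (∀ K t, |t| ≤ l₀ → ∀ τ ∈ T K \ Bad K t, ∀ v ∈ Adm, ∀ (x : B7Prop1Explicit.Site 4) (κ κ' : Fin 4),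
      ‖((hol (VA K t τ v) x (plaqWord κ κ') : (Matrix n n ℂ)ˣ) : Matrix n n ℂ) - 1‖
        ≤ cReg a₀ a₁ * ε₁ * (((L : ℝ) ^ K)⁻¹) ^ 2) ∧
    (∀ K t, |t| ≤ l₀ → ∀ τ ∈ T K \ Bad K t, ∀ v ∈ Adm, ∀ (P : Fin 4 × Fin 4) (z : B7Prop1Explicit.Site 4) (κ : Fin 4),
      ‖((VA K t τ v z κ : (Matrix n n ℂ)ˣ) : Matrix n n ℂ) * phiM (VA K t τ v) P (z + e κ)
          * (((VA K t τ v z κ)⁻¹ : (Matrix n n ℂ)ˣ) : Matrix n n ℂ) - phiM (VA K t τ v) P z‖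
        ≤ (4 * a₂ + 100 * a₀ * a₁ + 132 * a₀ ^ 3) * ε₁ * (((L : ℝ) ^ K)⁻¹) ^ 3) ∧
    (∀ K, 0 ≤ (4 * a₂ + 100 * a₀ * a₁ + 132 * a₀ ^ 3) * ε₁ * (((L : ℝ) ^ K)⁻¹) ^ 3 ∧
      (4 * a₂ + 100 * a₀ * a₁ + 132 * a₀ ^ 3) * ε₁ * (((L : ℝ) ^ K)⁻¹) ^ 3
        ≤ cOscReg L a₀ a₁ a₂ * ε₁ * (((L : ℝ) ^ (K + 1))⁻¹) ^ 2 * ((L : ℝ) ^ K)⁻¹) := by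
  have hL1 : (1 : ℝ) ≤ L := by exact_mod_cast (le_trans one_le_two hL)
  have hLne : (L : ℝ) ≠ 0 := by positivity
  have hq : ∀ K, 0 ≤ ((L : ℝ) ^ K)⁻¹ ∧ ((L : ℝ) ^ K)⁻¹ ≤ 1 := fun K =>
    ⟨by positivity, inv_le_one_of_one_le₀ (one_le_pow₀ hL1)⟩
  have hc : 0 ≤ cReg a₀ a₁ := cReg_nonneg a₀ ha₁
  have hb : a₀ * ε₁ ≤ 1 / 64 := a₀ε₁_le_of_smallness hL ha₀ ha₁ hε₁ hε₁1 hsmall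
  have hb₀ : ∀ K, 0 ≤ a₀ * ε₁ * ((L : ℝ) ^ K)⁻¹ ∧ a₀ * ε₁ * ((L : ℝ) ^ K)⁻¹ ≤ 1 / 64 := fun K =>
    ⟨mul_nonneg (mul_nonneg ha₀ hε₁) (hq K).1,
      (mul_le_of_le_one_right (mul_nonneg ha₀ hε₁) (hq K).2).trans hb⟩
  have hb₁ : ∀ K, 0 ≤ a₁ * ε₁ * (((L : ℝ) ^ K)⁻¹) ^ 2 := fun K => by have := (hq K).1; positivity
  have he2 : ε₁ ^ 2 ≤ ε₁ := by nlinarith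
  have he3 : ε₁ ^ 3 ≤ ε₁ := by nlinarith
  refine ⟨fun K => ⟨by have := (hq K).1; positivity, ?_⟩, fun K t ht τ hτ v hv x κ κ' => ?_,
    fun K t ht τ hτ v hv P z κ => ?_, fun K => ⟨by have := (hq K).1; positivity, le_of_eq ?_⟩⟩
  · have h1 : (((L : ℝ) ^ K)⁻¹) ^ 2 ≤ 1 := pow_le_one₀ (hq K).1 (hq K).2
    calc 20480 * (L : ℝ) ^ 2 * (cReg a₀ a₁ * ε₁ * (((L : ℝ) ^ K)⁻¹) ^ 2)
        ≤ 20480 * (L : ℝ) ^ 2 * (cReg a₀ a₁ * ε₁ * 1) := by gcongr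
      _ ≤ 1 := by simpa using hsmall
  · refine ((hreg K t ht τ hτ v hv x).norm_hol_plaq_sub_one_le (by norm_num) (hb₀ K).1 (hb₀ K).2 κ κ').trans ?_
    have hx : 0 ≤ a₀ ^ 2 * (((L : ℝ) ^ K)⁻¹) ^ 2 * (ε₁ - ε₁ ^ 2) :=
      mul_nonneg (by have := (hq K).1; positivity) (by linarith)
    unfold cReg
    nlinarith
  · refine (phiM_osc_le_of_locReg (hreg K t ht τ hτ v hv z) le_rfl (hb₀ K).1 (hb₀ K).2 (hb₁ K) P κ).trans ?_
    have hq3 : 0 ≤ (((L : ℝ) ^ K)⁻¹) ^ 3 := pow_nonneg (hq K).1 3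
    have hx₁ : 0 ≤ a₀ * a₁ * (((L : ℝ) ^ K)⁻¹) ^ 3 * (ε₁ - ε₁ ^ 2) :=
      mul_nonneg (by positivity) (by linarith)
    have hx₂ : 0 ≤ a₀ ^ 3 * (((L : ℝ) ^ K)⁻¹) ^ 3 * (ε₁ - ε₁ ^ 3) :=
      mul_nonneg (by positivity) (by linarith)
    nlinarith
  · unfold cOscReg
    rw [pow_succ]
    field_simp
    ring

/-- **(U)(L) FOR `U(N)` WILSON TERMS FROM LOCAL REGULARITY — ONE CALL of generation 13's
`T4TermwiseChainUN.interpolation_averaging_UN` with its binders `hαK`, `hA`/`hB` ((44)), `hAosc` ((44∇)), `hcα`,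
`hdecay`, `hα₁K` DISCHARGED by `binders_of_locReg` (for run A; for run B only unitarity/periodicity/(44) are
consumed).**  REMAINING hypotheses, BY NAME: the two runs' backgrounds are `U(N)`-valued and `M·L^{K+1}`-periodic
(`hAU`/`hBU`), are `LocReg` about every site with radii `(a₀,a₁,a₂)·ε₁·L^{−K,−2K,−3K}` (`hAreg`/`hBreg` — the
background-regularity INPUT, NOT PRINTED as used here), `0 ≤ ε₁ ≤ 1`, the smallness `20480·L²·cReg·ε₁ ≤ 1`, (repr)
`hreprU`/`hreprL`, `2 ≤ M`, `2 ≤ L`, genuine planes.  OUTPUT: the per-term deviation bounds with the explicit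
geometric majorants `M⁴·dUN N L #planes cReg cOscReg ε₁ K`, `M⁴·dLN N L #planes cReg ε₁ K`, nonnegative and SUMMABLE.
NOT NE7, NOT Clay. [folklore] -/
theorem interpolation_averaging_UN_of_locReg {Y YA : Type*} {g : ℕ → ℝ → σ → ι → YA → ℝ}
    {f₁ : ℕ → ℝ → σ → ι → Y → ℝ} {Q : ℕ → ℝ → σ → ι → Y → YA} {yA yB : ℕ → ℝ → σ → ι → Y}
    {xA : ℕ → ℝ → σ → ι → YA}
    (M L : ℕ) (hM : 2 ≤ M) (hL : 2 ≤ L) (planes : Finset (Fin 4 × Fin 4)) (hplanes : ∀ P ∈ planes, P.1 ≠ P.2)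
    (VA VB : ℕ → ℝ → σ → ι → (B7Prop1Explicit.Site 4 → Fin 4 → (Matrix n n ℂ)ˣ))
    {a₀ a₁ a₂ ε₁ : ℝ}
    (ha₀ : 0 ≤ a₀) (ha₁ : 0 ≤ a₁) (ha₂ : 0 ≤ a₂) (hε₁1 : ε₁ ≤ 1)
    (hsmall : 20480 * (L : ℝ) ^ 2 * (cReg a₀ a₁ * ε₁) ≤ 1)
    (hAU : ∀ K t, |t| ≤ l₀ → ∀ τ ∈ T K \ Bad K t, ∀ v ∈ Adm,
      (∀ x κ, VA K t τ v x κ ∈ unitaryUnits (Matrix n n ℂ)) ∧ IsPeriodic (M * L ^ K * L) (VA K t τ v))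
    (hBU : ∀ K t, |t| ≤ l₀ → ∀ τ ∈ T K \ Bad K t, ∀ v ∈ Adm,
      (∀ x κ, VB K t τ v x κ ∈ unitaryUnits (Matrix n n ℂ)) ∧ IsPeriodic (M * L ^ K * L) (VB K t τ v))
    (hAreg : ∀ K t, |t| ≤ l₀ → ∀ τ ∈ T K \ Bad K t, ∀ v ∈ Adm, ∀ z : B7Prop1Explicit.Site 4,
      LocReg (VA K t τ v) z 5 (a₀ * ε₁ * ((L : ℝ) ^ K)⁻¹) (a₁ * ε₁ * (((L : ℝ) ^ K)⁻¹) ^ 2)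
        (a₂ * ε₁ * (((L : ℝ) ^ K)⁻¹) ^ 3))
    (hBreg : ∀ K t, |t| ≤ l₀ → ∀ τ ∈ T K \ Bad K t, ∀ v ∈ Adm, ∀ z : B7Prop1Explicit.Site 4,
      LocReg (VB K t τ v) z 5 (a₀ * ε₁ * ((L : ℝ) ^ K)⁻¹) (a₁ * ε₁ * (((L : ℝ) ^ K)⁻¹) ^ 2)
        (a₂ * ε₁ * (((L : ℝ) ^ K)⁻¹) ^ 3))
    (hreprU : ∀ K t, |t| ≤ l₀ → ∀ τ ∈ T K \ Bad K t, ∀ v ∈ Adm,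
      f₁ K t τ v (yA K t τ v) = ∑ x ∈ pbox planes (M * L ^ K * L), eN (phiU (VA K t τ v) x) ∧
        g K t τ v (xA K t τ v) = ∑ y ∈ pbox planes (M * L ^ K), eN (psiU L (VA K t τ v) y))
    (hreprL : ∀ K t, |t| ≤ l₀ → ∀ τ ∈ T K \ Bad K t, ∀ v ∈ Adm,
      f₁ K t τ v (yB K t τ v) = ∑ x ∈ pbox planes (M * L ^ K * L), eN (phiU (VB K t τ v) x) ∧
        g K t τ v (Q K t τ v (yB K t τ v)) = ∑ y ∈ pbox planes (M * L ^ K), eN (psiU L (VB K t τ v) y))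
    (hε₁ : 0 ≤ ε₁) :
    (∀ K t, |t| ≤ l₀ → ∀ τ ∈ T K \ Bad K t, ∀ v ∈ Adm,
      f₁ K t τ v (yA K t τ v) - g K t τ v (xA K t τ v)
        ≤ (M : ℝ) ^ 4 * dUN (Fintype.card n) L planes.card (cReg a₀ a₁) (cOscReg L a₀ a₁ a₂) ε₁ K) ∧
    (∀ K t, |t| ≤ l₀ → ∀ τ ∈ T K \ Bad K t, ∀ v ∈ Adm,
      g K t τ v (Q K t τ v (yB K t τ v)) - f₁ K t τ v (yB K t τ v)
        ≤ (M : ℝ) ^ 4 * dLN (Fintype.card n) L planes.card (cReg a₀ a₁) ε₁ K) ∧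
    (∀ K, 0 ≤ dUN (Fintype.card n) L planes.card (cReg a₀ a₁) (cOscReg L a₀ a₁ a₂) ε₁ K) ∧
    (∀ K, 0 ≤ dLN (Fintype.card n) L planes.card (cReg a₀ a₁) ε₁ K) ∧
    Summable (dUN (Fintype.card n) L planes.card (cReg a₀ a₁) (cOscReg L a₀ a₁ a₂) ε₁) ∧
    Summable (dLN (Fintype.card n) L planes.card (cReg a₀ a₁) ε₁) := by
  obtain ⟨hαK, hA44, hAosc, hα₁K⟩ := binders_of_locReg (l₀ := l₀) (T := T) (Bad := Bad) (Adm := Adm) L hL VA ha₀ ha₁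
    ha₂ hε₁ hε₁1 hsmall hAreg
  obtain ⟨-, hB44, -, -⟩ := binders_of_locReg (l₀ := l₀) (T := T) (Bad := Bad) (Adm := Adm) L hL VB ha₀ ha₁ ha₂
    hε₁ hε₁1 hsmall hBreg
  exact interpolation_averaging_UN (g := g) (f₁ := f₁) (Q := Q) (yA := yA) (yB := yB) (xA := xA)
    (αK := fun K => cReg a₀ a₁ * ε₁ * (((L : ℝ) ^ K)⁻¹) ^ 2)
    (α₁K := fun K => (4 * a₂ + 100 * a₀ * a₁ + 132 * a₀ ^ 3) * ε₁ * (((L : ℝ) ^ K)⁻¹) ^ 3)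
    (cα := cReg a₀ a₁) (cα₁ := cOscReg L a₀ a₁ a₂) (ε₁ := ε₁)
    M L hM hL planes hplanes VA VB hαK
    (fun K t ht τ hτ v hv =>
      ⟨(hAU K t ht τ hτ v hv).1, (hAU K t ht τ hτ v hv).2, fun x κ κ' _ => hA44 K t ht τ hτ v hv x κ κ'⟩)
    (fun K t ht τ hτ v hv =>
      ⟨(hBU K t ht τ hτ v hv).1, (hBU K t ht τ hτ v hv).2, fun x κ κ' _ => hB44 K t ht τ hτ v hv x κ κ'⟩)
    (fun K t ht τ hτ v hv P _ z κ => hAosc K t ht τ hτ v hv P z κ)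
    (cReg_nonneg a₀ ha₁) (fun K => le_rfl) hα₁K hreprU hreprL hε₁

end UN

/-! ## §7 The good-class half with `Summable δ⁗` for G = U(N) Wilson terms, background binders from local regularity -/

section Ledger

variable {n : Type*} [Fintype n] [DecidableEq n] [Nonempty n]
variable {C : T4BoundaryCarrier.Carriers} {ι : Type} [MeasurableSpace ι] {σ : Type*} [DecidableEq σ] {l₀ vol : ℝ}
  {T : ℕ → Finset σ} {Bad : ℕ → ℝ → Finset σ} {A B : ℕ → ℝ → σ → ℝ} {μ : ℕ → ℝ → σ → Measure ι}
  {fac bfac rfac : ℕ → ℝ → σ → Finset C.Dom} {Adm : Set ι} {EA : Functional C.toCarriers C.BgA}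
  {EB : Functional C.toCarriers C.BgB} {BA : BFunctional C C.BgA} {BB : BFunctional C C.BgB}
  {RA : Functional C.toCarriers C.BgA} {RB : Functional C.toCarriers C.BgB}
  {κ θ' Cr EB₀ CrR R₁ b β' w₀ : ℝ} {κ₀ : ℕ} {gA gB : ℕ → ℕ → ℝ} {gfA gfB : ℕ → ℝ} {gsA gsB : ℕ → ℕ → ℝ}
  {uA : ℕ → ι → C.BgA} {uB : ℕ → ι → C.BgB} {oneA : C.BgA} {oneB : C.BgB}
  {pend : ℕ → ℝ → σ → ι → C.Fl} {nA nB aA aB wA wB γA γB : ℕ → ℝ → σ → ι → ℝ} {qA qB : ℕ → ℝ}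
  {κ₁ S : ℕ → ℝ → σ → ℕ → ℝ} {cW RW : ℕ → ℝ → σ → ℝ} {rw sw rγ zA zB c₀ : ℕ → ℝ} {Cw E a Λ Cl : ℝ}

/-- **THE GOOD-CLASS HALF WITH `Summable δ⁗` FOR G = U(N) WILSON TERMS, BACKGROUND BINDERS FROM LOCAL REGULARITY:
generation 13's `goodClause_summable_UN` with `hαK`, `hA`, `hB`, `hAosc`, `hcα`, `hdecay`, `hα₁K` SUPPLIED by
`binders_of_locReg`.**  Every other ledger binder is carried BY NAME and VERBATIM (none discharged) — in particular the
flow window (0.31) of [Balaban1987RG1] sits in `h031A`/`h031B`; the `U(N)` term-wise inputs (repr) `hreprU hreprL`, the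
backgrounds' unitarity/periodicity `hAU hBU`, their LOCAL REGULARITY `hAreg hBreg` (the INPUT that replaces (44),
(44∇) and both decay laws; NOT PRINTED as used here), `0 ≤ ε₁ ≤ 1`, the smallness `20480·L²·cReg·ε₁ ≤ 1`, `2 ≤ M`,
`2 ≤ L`, genuine planes and `M⁴ ≤ vol` are hypotheses.  OUTPUT: the good clause with `δ⁗` whose action-kind share is
`w₀·(dUN N L #planes cReg cOscReg ε₁ K + dLN N L #planes cReg ε₁ K)`, and `Summable δ⁗`.  No print is quoted;
nothing printed is asserted; NOT NE7, NOT Clay. [folklore] -/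
theorem goodClause_summable_UN_of_locReg {Y YA : Type*} {Sfib : ℕ → ℝ → σ → ι → Set Y}
    {SfibA : ℕ → ℝ → σ → ι → Set YA} {g : ℕ → ℝ → σ → ι → YA → ℝ} {f₁ : ℕ → ℝ → σ → ι → Y → ℝ}
    {Q : ℕ → ℝ → σ → ι → Y → YA} {yA yB : ℕ → ℝ → σ → ι → Y} {xA : ℕ → ℝ → σ → ι → YA}
    (M L : ℕ) (hMtwo : 2 ≤ M) (hLtwo : 2 ≤ L) (planes : Finset (Fin 4 × Fin 4))
    (hplanes : ∀ P ∈ planes, P.1 ≠ P.2)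
    (VA VB : ℕ → ℝ → σ → ι → (B7Prop1Explicit.Site 4 → Fin 4 → (Matrix n n ℂ)ˣ))
    {a₀ a₁ a₂ ε₁ : ℝ}
    (hUR : ∀ K, URateUpTo K EA EB (gA K) (gB K) (uA K) (uB K) Adm Cr θ' κ) (hCr : 0 ≤ Cr)
    (hθ'0 : 0 < θ') (hθ'1 : θ' < 1) (hθ'Λ : θ' ≤ Λ) (hΛ1 : 1 ≤ Λ) (hCl : 0 ≤ Cl)
    (hURB : ∀ b ∈ C.admFl, ∀ K, URateUpTo K (atFl BA b) (atFl BB b) (gA K) (gB K) (uA K) (uB K) Adm EB₀ θ' κ)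
    (hEB₀ : 0 ≤ EB₀)
    (hURR : ∀ K, URateUpTo K RA RB (gA K) (gB K) (uA K) (uB K) Adm CrR θ' κ) (hCrR : 0 ≤ CrR)
    (hfmtA : ∀ K t τ, A K t τ = ∫ v, (∏ X ∈ fac K t τ,
      Real.exp (EA (gA K) (uA K v) X - EA (gA K) oneA X)) *
        ((∏ X ∈ bfac K t τ, Real.exp (BA (gA K) (uA K v) (pend K t τ v) X)) * nA K t τ v * qA K *
          ((∏ X ∈ rfac K t τ, Real.exp (RA (gA K) (uA K v) X - RA (gA K) oneA X)) * (Real.exp (-aA K t τ v) * wA K t τ v)))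
          ∂(μ K t τ))
    (hfmtB : ∀ K t τ, B K t τ = ∫ v, (∏ X ∈ fac K t τ,
      Real.exp (EB (gB K) (uB K v) X - EB (gB K) oneB X)) *
        ((∏ X ∈ bfac K t τ, Real.exp (BB (gB K) (uB K v) (pend K t τ v) X)) * nB K t τ v * qB K *
          ((∏ X ∈ rfac K t τ, Real.exp (RB (gB K) (uB K v) X - RB (gB K) oneB X)) * (Real.exp (-aB K t τ v) * wB K t τ v)))
          ∂(μ K t τ))
    (hint : ∀ K t, |t| ≤ l₀ → ∀ τ ∈ T K \ Bad K t,
      Integrable (fun v => (∏ X ∈ fac K t τ, Real.exp (EA (gA K) (uA K v) X - EA (gA K) oneA X)) *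
        ((∏ X ∈ bfac K t τ, Real.exp (BA (gA K) (uA K v) (pend K t τ v) X)) * nA K t τ v * qA K *
          ((∏ X ∈ rfac K t τ, Real.exp (RA (gA K) (uA K v) X - RA (gA K) oneA X)) * (Real.exp (-aA K t τ v) * wA K t τ v))))
          (μ K t τ) ∧
      Integrable (fun v => (∏ X ∈ fac K t τ, Real.exp (EB (gB K) (uB K v) X - EB (gB K) oneB X)) *
        ((∏ X ∈ bfac K t τ, Real.exp (BB (gB K) (uB K v) (pend K t τ v) X)) * nB K t τ v * qB K *
          ((∏ X ∈ rfac K t τ, Real.exp (RB (gB K) (uB K v) X - RB (gB K) oneB X)) * (Real.exp (-aB K t τ v) * wB K t τ v))))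
          (μ K t τ))
    (hsc : ∀ K t, |t| ≤ l₀ → ∀ τ ∈ T K \ Bad K t, ∀ X ∈ fac K t τ, C.scale X ≤ K)
    (hoff : ∀ K t, |t| ≤ l₀ → ∀ τ ∈ T K \ Bad K t, ∀ v, v ∉ Adm →
      (∏ X ∈ fac K t τ, Real.exp (EA (gA K) (uA K v) X - EA (gA K) oneA X)) *
        ((∏ X ∈ bfac K t τ, Real.exp (BA (gA K) (uA K v) (pend K t τ v) X)) * nA K t τ v * qA K *
          ((∏ X ∈ rfac K t τ, Real.exp (RA (gA K) (uA K v) X - RA (gA K) oneA X)) * (Real.exp (-aA K t τ v) * wA K t τ v)))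
          = 0 ∧
      (∏ X ∈ fac K t τ, Real.exp (EB (gB K) (uB K v) X - EB (gB K) oneB X)) *
        ((∏ X ∈ bfac K t τ, Real.exp (BB (gB K) (uB K v) (pend K t τ v) X)) * nB K t τ v * qB K *
          ((∏ X ∈ rfac K t τ, Real.exp (RB (gB K) (uB K v) X - RB (gB K) oneB X)) * (Real.exp (-aB K t τ v) * wB K t τ v)))
          = 0)
    (hS : ∀ K t, |t| ≤ l₀ → ∀ τ ∈ T K \ Bad K t, ∀ v ∈ Adm, ∀ j ≤ K,
      |(∑ X ∈ fac K t τ with C.scale X = j,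
          (Real.log (Real.exp (EB (gB K) (uB K v) X - EB (gB K) oneB X))
            - Real.log (Real.exp (EA (gA K) (uA K v) X - EA (gA K) oneA X)))) - κ₁ K t τ j| ≤ S K t τ j)
    (hM : ∀ K t, |t| ≤ l₀ → ∀ τ ∈ T K \ Bad K t,
      Multiplicity (fac K t τ) C.scale (fun X => Real.exp (-(κ * C.d X))) Cw vol Λ K)
    (hwit : ∀ K, ∃ v₁ ∈ Adm, uA K v₁ = oneA ∧ uB K v₁ = oneB)
    (hvol : 0 ≤ vol) (hE : 0 ≤ E) (ha0 : 0 < a) (ha1 : a < 1)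
    (hSle : ∀ K t, |t| ≤ l₀ → ∀ τ ∈ T K \ Bad K t, ∀ j ≤ K, S K t τ j ≤ vol * (E * a ^ (K - j)))
    (hpend : ∀ K t, |t| ≤ l₀ → ∀ τ ∈ T K \ Bad K t, ∀ v ∈ Adm, pend K t τ v ∈ C.admFl)
    (hBwin : ∀ K t, |t| ≤ l₀ → ∀ τ ∈ T K \ Bad K t, RecentOnly (bfac K t τ) C.scale (jlogOf Cl K) K)
    (hMB : ∀ K t, |t| ≤ l₀ → ∀ τ ∈ T K \ Bad K t,
      Multiplicity (bfac K t τ) C.scale (fun X => Real.exp (-(κ * C.d X))) Cw vol Λ K)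
    (hnpos : ∀ K t, |t| ≤ l₀ → ∀ τ ∈ T K \ Bad K t, ∀ v ∈ Adm, 0 < nA K t τ v ∧ 0 < nB K t τ v)
    (hzA : ∀ K t, |t| ≤ l₀ → ∀ τ ∈ T K \ Bad K t, ∀ v ∈ Adm, |Real.log (nA K t τ v)| ≤ vol * zA K)
    (hzB : ∀ K t, |t| ≤ l₀ → ∀ τ ∈ T K \ Bad K t, ∀ v ∈ Adm, |Real.log (nB K t τ v)| ≤ vol * zB K)
    (hzAs : Summable zA) (hzBs : Summable zB)
    (hq : ∀ K, 0 < qA K ∧ 0 < qB K)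
    -- the 𝐑-kind: scales, multiplicity, one-run slice sizes, the flow window of both coupling tables
    (hrsc : ∀ K t, |t| ≤ l₀ → ∀ τ ∈ T K \ Bad K t, ∀ X ∈ rfac K t τ, C.scale X ≤ K)
    (hMR : ∀ K t, |t| ≤ l₀ → ∀ τ ∈ T K \ Bad K t,
      Multiplicity (rfac K t τ) C.scale (fun X => Real.exp (-(κ * C.d X))) Cw vol Λ K)
    (hRSA : ∀ K t, |t| ≤ l₀ → ∀ τ ∈ T K \ Bad K t, ∀ v ∈ Adm, ∀ j ≤ K,
      |∑ X ∈ rfac K t τ with C.scale X = j, (RA (gA K) (uA K v) X - RA (gA K) oneA X)| ≤ vol * (R₁ * gsA K j ^ κ₀))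
    (hRSB : ∀ K t, |t| ≤ l₀ → ∀ τ ∈ T K \ Bad K t, ∀ v ∈ Adm, ∀ j ≤ K,
      |∑ X ∈ rfac K t τ with C.scale X = j, (RB (gB K) (uB K v) X - RB (gB K) oneB X)| ≤ vol * (R₁ * gsB K j ^ κ₀))
    (hb : 0 < b) (h031A : ∀ K, Step.Discrete031 b β' K (gfA K) (gsA K))
    (h031B : ∀ K, Step.Discrete031 b β' K (gfB K) (gsB K)) (hgsA : ∀ K k, k ≤ K → 0 ≤ gsA K k)
    (hgsB : ∀ K k, k ≤ K → 0 ≤ gsB K k) (hR₁ : 0 ≤ R₁) (hκ₀ : 4 < κ₀)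
    -- the ACTION kind from ONE CLASSICAL STEP: (min-A) (Q) (lift) (min-B) (act) (U) (L) (γ)
    (hminA : ∀ K t, |t| ≤ l₀ → ∀ τ ∈ T K \ Bad K t, ∀ v ∈ Adm, IsMinOn (g K t τ v) (SfibA K t τ v) (xA K t τ v))
    (hQ : ∀ K t, |t| ≤ l₀ → ∀ τ ∈ T K \ Bad K t, ∀ v ∈ Adm, Set.MapsTo (Q K t τ v) (Sfib K t τ v) (SfibA K t τ v))
    (hlift : ∀ K t, |t| ≤ l₀ → ∀ τ ∈ T K \ Bad K t, ∀ v ∈ Adm,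
      yA K t τ v ∈ Sfib K t τ v ∧ Q K t τ v (yA K t τ v) = xA K t τ v)
    (hminB : ∀ K t, |t| ≤ l₀ → ∀ τ ∈ T K \ Bad K t, ∀ v ∈ Adm,
      yB K t τ v ∈ Sfib K t τ v ∧ IsMinOn (f₁ K t τ v) (Sfib K t τ v) (yB K t τ v))
    (hact : ∀ K t, |t| ≤ l₀ → ∀ τ ∈ T K \ Bad K t, ∀ v ∈ Adm,
      aA K t τ v = w₀ * g K t τ v (xA K t τ v) + γA K t τ v ∧
        aB K t τ v = w₀ * f₁ K t τ v (yB K t τ v) + γB K t τ v)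
    (hw₀ : 0 ≤ w₀)
    -- (U)(L) PRODUCED for G = U(N) Wilson terms (`interpolation_averaging_UN_of_locReg`): (repr) `hreprU hreprL`,
    -- unitarity/periodicity `hAU hBU`, LOCAL REGULARITY `hAreg hBreg` (from which (44), (44∇), the smallness and both
    -- decay laws are DERIVED), `ε₁ ≤ 1`, the smallness `20480·L²·cReg·ε₁ ≤ 1`, `hε₁`, and `M⁴ ≤ vol`
    (ha₀ : 0 ≤ a₀) (ha₁ : 0 ≤ a₁) (ha₂ : 0 ≤ a₂) (hε₁1 : ε₁ ≤ 1)
    (hsmall : 20480 * (L : ℝ) ^ 2 * (cReg a₀ a₁ * ε₁) ≤ 1)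
    (hAU : ∀ K t, |t| ≤ l₀ → ∀ τ ∈ T K \ Bad K t, ∀ v ∈ Adm,
      (∀ x κ, VA K t τ v x κ ∈ unitaryUnits (Matrix n n ℂ)) ∧ IsPeriodic (M * L ^ K * L) (VA K t τ v))
    (hBU : ∀ K t, |t| ≤ l₀ → ∀ τ ∈ T K \ Bad K t, ∀ v ∈ Adm,
      (∀ x κ, VB K t τ v x κ ∈ unitaryUnits (Matrix n n ℂ)) ∧ IsPeriodic (M * L ^ K * L) (VB K t τ v))
    (hAreg : ∀ K t, |t| ≤ l₀ → ∀ τ ∈ T K \ Bad K t, ∀ v ∈ Adm, ∀ z : B7Prop1Explicit.Site 4,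
      LocReg (VA K t τ v) z 5 (a₀ * ε₁ * ((L : ℝ) ^ K)⁻¹) (a₁ * ε₁ * (((L : ℝ) ^ K)⁻¹) ^ 2)
        (a₂ * ε₁ * (((L : ℝ) ^ K)⁻¹) ^ 3))
    (hBreg : ∀ K t, |t| ≤ l₀ → ∀ τ ∈ T K \ Bad K t, ∀ v ∈ Adm, ∀ z : B7Prop1Explicit.Site 4,
      LocReg (VB K t τ v) z 5 (a₀ * ε₁ * ((L : ℝ) ^ K)⁻¹) (a₁ * ε₁ * (((L : ℝ) ^ K)⁻¹) ^ 2)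
        (a₂ * ε₁ * (((L : ℝ) ^ K)⁻¹) ^ 3))
    (hreprU : ∀ K t, |t| ≤ l₀ → ∀ τ ∈ T K \ Bad K t, ∀ v ∈ Adm,
      f₁ K t τ v (yA K t τ v) = ∑ x ∈ pbox planes (M * L ^ K * L), eN (phiU (VA K t τ v) x) ∧
        g K t τ v (xA K t τ v) = ∑ y ∈ pbox planes (M * L ^ K), eN (psiU L (VA K t τ v) y))
    (hreprL : ∀ K t, |t| ≤ l₀ → ∀ τ ∈ T K \ Bad K t, ∀ v ∈ Adm,
      f₁ K t τ v (yB K t τ v) = ∑ x ∈ pbox planes (M * L ^ K * L), eN (phiU (VB K t τ v) x) ∧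
        g K t τ v (Q K t τ v (yB K t τ v)) = ∑ y ∈ pbox planes (M * L ^ K), eN (psiU L (VB K t τ v) y))
    (hε₁ : 0 ≤ ε₁) (hMvol : ((M : ℝ)) ^ 4 ≤ vol)
    (hγ : ∀ K t, |t| ≤ l₀ → ∀ τ ∈ T K \ Bad K t, ∀ v ∈ Adm, |γB K t τ v - γA K t τ v| ≤ vol * rγ K)
    (hrγ : Summable rγ)
    -- the residual kind after generation 8: (R-w) radii about a centre `cW`, (W-w) the WITNESS log-ratio centred
    (hwpos : ∀ K t, |t| ≤ l₀ → ∀ τ ∈ T K \ Bad K t, ∀ v ∈ Adm, 0 < wA K t τ v ∧ 0 < wB K t τ v)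
    (hRw : ∀ K t, |t| ≤ l₀ → ∀ τ ∈ T K \ Bad K t, ∀ v ∈ Adm,
      |Real.log (wB K t τ v) - Real.log (wA K t τ v) - cW K t τ| ≤ RW K t τ)
    (hRRw : ∀ K t, |t| ≤ l₀ → ∀ τ ∈ T K \ Bad K t, RW K t τ ≤ vol * rw K) (hrw : Summable rw)
    (hWw : ∀ K t, |t| ≤ l₀ → ∀ τ ∈ T K \ Bad K t, ∀ v ∈ Adm, uA K v = oneA → uB K v = oneB →
      |Real.log (wB K t τ v) - Real.log (wA K t τ v) - c₀ K| ≤ vol * sw K)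
    (hsw : Summable sw) :
    GoodClause l₀ vol T A B Bad
        (fun K => (max Cw 1 * ((E + Cr) * ∑ x ∈ antidiagonal K, min (a ^ x.2) (θ' ^ x.1 * Λ ^ x.2))
            + (EB₀ * Cw * windowSum θ' Λ (jlogOf Cl K) K + (zA K + zB K)
              + (max (2 * Cw) 1 * ((∑ p ∈ antidiagonal K, min (R₁ * gsA K p.1 ^ κ₀) (CrR * θ' ^ p.1 * Λ ^ p.2))
                  + ∑ p ∈ antidiagonal K, min (R₁ * gsB K p.1 ^ κ₀) (CrR * θ' ^ p.1 * Λ ^ p.2))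
                + (w₀ * (dUN (Fintype.card n) L planes.card (cReg a₀ a₁) (cOscReg L a₀ a₁ a₂) ε₁ K + dLN (Fintype.card n) L planes.card (cReg a₀ a₁) ε₁ K)
                  + rγ K + rw K))))
          + (max Cw 1 * ((E + Cr) * ∑ x ∈ antidiagonal K, min (a ^ x.2) (θ' ^ x.1 * Λ ^ x.2)) + (rw K + sw K))) ∧
      Summable (fun K => (max Cw 1 * ((E + Cr) * ∑ x ∈ antidiagonal K, min (a ^ x.2) (θ' ^ x.1 * Λ ^ x.2))
            + (EB₀ * Cw * windowSum θ' Λ (jlogOf Cl K) K + (zA K + zB K)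
              + (max (2 * Cw) 1 * ((∑ p ∈ antidiagonal K, min (R₁ * gsA K p.1 ^ κ₀) (CrR * θ' ^ p.1 * Λ ^ p.2))
                  + ∑ p ∈ antidiagonal K, min (R₁ * gsB K p.1 ^ κ₀) (CrR * θ' ^ p.1 * Λ ^ p.2))
                + (w₀ * (dUN (Fintype.card n) L planes.card (cReg a₀ a₁) (cOscReg L a₀ a₁ a₂) ε₁ K + dLN (Fintype.card n) L planes.card (cReg a₀ a₁) ε₁ K)
                  + rγ K + rw K))))
          + (max Cw 1 * ((E + Cr) * ∑ x ∈ antidiagonal K, min (a ^ x.2) (θ' ^ x.1 * Λ ^ x.2)) + (rw K + sw K))) := by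
  obtain ⟨hαK, hA44, hAosc, hα₁K⟩ := binders_of_locReg (l₀ := l₀) (T := T) (Bad := Bad) (Adm := Adm) L hLtwo VA ha₀
    ha₁ ha₂ hε₁ hε₁1 hsmall hAreg
  obtain ⟨-, hB44, -, -⟩ := binders_of_locReg (l₀ := l₀) (T := T) (Bad := Bad) (Adm := Adm) L hLtwo VB ha₀ ha₁
    ha₂ hε₁ hε₁1 hsmall hBreg
  exact goodClause_summable_UN (Sfib := Sfib) (SfibA := SfibA) (g := g) (f₁ := f₁) (Q := Q) (yA := yA) (yB := yB)
    (xA := xA) (αK := fun K => cReg a₀ a₁ * ε₁ * (((L : ℝ) ^ K)⁻¹) ^ 2)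
    (α₁K := fun K => (4 * a₂ + 100 * a₀ * a₁ + 132 * a₀ ^ 3) * ε₁ * (((L : ℝ) ^ K)⁻¹) ^ 3)
    (cα := cReg a₀ a₁) (cα₁ := cOscReg L a₀ a₁ a₂) (ε₁ := ε₁)
    M L hMtwo hLtwo planes hplanes VA VB hUR hCr hθ'0 hθ'1 hθ'Λ hΛ1 hCl hURB hEB₀ hURR hCrR hfmtA hfmtB hint hsc
    hoff hS hM hwit hvol hE ha0 ha1 hSle hpend hBwin hMB hnpos hzA hzB hzAs hzBs hq hrsc hMR hRSA hRSB hb h031A h031B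
    hgsA hgsB hR₁ hκ₀ hminA hQ hlift hminB hact hw₀ hαK
    (fun K t ht τ hτ v hv =>
      ⟨(hAU K t ht τ hτ v hv).1, (hAU K t ht τ hτ v hv).2, fun x κ κ' _ => hA44 K t ht τ hτ v hv x κ κ'⟩)
    (fun K t ht τ hτ v hv =>
      ⟨(hBU K t ht τ hτ v hv).1, (hBU K t ht τ hτ v hv).2, fun x κ κ' _ => hB44 K t ht τ hτ v hv x κ κ'⟩)
    (fun K t ht τ hτ v hv P _ z κ => hAosc K t ht τ hτ v hv P z κ)
    (cReg_nonneg a₀ ha₁) (fun K => le_rfl) hα₁K hreprU hreprL hε₁ hMvol hγ hrγ hwpos hRw hRRw hrw hWw hsw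

end Ledger

/-! ## §8 Toys (non-vacuity of the new hypotheses; the constants at trivial points) -/

section Toy

/-- The constant `U(3)` configuration satisfies the hypotheses `hAU`/`hAreg` of the theorems of §6–§7 at every scale
with radii `a₀ = a₁ = a₂ = 0` (unitary, periodic of every period, `LocReg` about every site with `(0,0,0)`), and the
smallness holds: the hypothesis set is satisfiable. [folklore] -/
theorem const_config_locReg_U3 (Np : ℕ) (z : B7Prop1Explicit.Site 4) (L K : ℕ) (ε₁ : ℝ) :
    (∀ (x : B7Prop1Explicit.Site 4) (κ : Fin 4),
        (fun (_ : B7Prop1Explicit.Site 4) (_ : Fin 4) => (1 : (Matrix (Fin 3) (Fin 3) ℂ)ˣ)) x κ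
          ∈ unitaryUnits (Matrix (Fin 3) (Fin 3) ℂ)) ∧
      IsPeriodic Np (fun (_ : B7Prop1Explicit.Site 4) (_ : Fin 4) => (1 : (Matrix (Fin 3) (Fin 3) ℂ)ˣ)) ∧
      LocReg (fun (_ : B7Prop1Explicit.Site 4) (_ : Fin 4) => (1 : (Matrix (Fin 3) (Fin 3) ℂ)ˣ)) z 5
        (0 * ε₁ * ((L : ℝ) ^ K)⁻¹) (0 * ε₁ * (((L : ℝ) ^ K)⁻¹) ^ 2) (0 * ε₁ * (((L : ℝ) ^ K)⁻¹) ^ 3) ∧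
      20480 * (L : ℝ) ^ 2 * (cReg 0 0 * ε₁) ≤ 1 := by
  refine ⟨fun _ _ => Subgroup.one_mem _, fun _ _ => rfl, ?_, by simp [cReg]⟩
  simpa using locReg_one (𝔸 := Matrix (Fin 3) (Fin 3) ℂ) z 5

/-- The smallness is also satisfiable with nonzero radii: `L = 2`, `a₀ = a₁ = 1`, `ε₁ = 10⁻⁷`. [folklore] -/
example : 20480 * ((2 : ℕ) : ℝ) ^ 2 * (cReg 1 1 * (1 / 10 ^ 7)) ≤ 1 := by norm_num [cReg]

/-- With all radii zero the produced constants vanish: `cReg 0 0 = 0`, `cOscReg L 0 0 0 = 0`, hence both majorants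
vanish (`T4TermwiseChainUN.dUN_dLN_zero` is the `ε₁ = 0` statement). [folklore] -/
theorem cReg_cOscReg_zero (L : ℕ) : cReg 0 0 = 0 ∧ cOscReg L 0 0 0 = 0 := by
  constructor <;> simp [cReg, cOscReg]

end Toy

end Summit.QuantumFields.BalabanUV.T4Continuum.TermwiseBackground
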